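import Mathlib
import Literature.Analysis.Calculus.RayTaylor
import Literature.RingTheory.MvPolynomial.SymmetricVectorFormEsymm
import Literature.RingTheory.MvPolynomial.WeightedHomogeneousEvalFinThree
import Literature.Analysis.Calculus.MultilinearWordExpansion
import Literature.Analysis.Calculus.BorelCutoffSeriesSeveral

/-!
# Formal part of Glaeser–Chevalley for `D₃` at the corner

Topic `Analysis/Calculus`. For a smooth Banach-valued `Φ : ℝ × ℝ × P → E` (parameter `P`
finite-dimensional) which is even in the second variable and invariant under the rotation by
`2π/3` of the first two variables — i.e. invariant under the dihedral group `D₃ ≅ S₃` — we construct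
a smooth `G₀ : ℝ × ℝ × P → E` such that `Φ (a, b, z) − G₀ (a² + b², a³ − 3ab², z)` vanishes to
infinite order along the corner line `a = b = 0` (value-flat form `O(‖(a,b)‖^N)` for every `N`,
locally uniformly in `z`). This is the FORMAL half of the smooth Newton∕Chevalley theorem for
`S₃` at its most degenerate point [Glaeser1963Newton, Thm. II]; the FLAT half is
★ `FlatCubeRootDescent` and the assembled theorem is ★ `GlaeserSymmetricThree`.

Route: Taylor forms `T_j(z; v) = Dʲ(Φ(·,·,z))(0)[v,…,v]` (value-flat Taylor expansion over
★ `RayTaylor`); they are `D₃`-invariant for free (`ContinuousLinearMap.iteratedFDeriv_comp_right`);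
through the Lagrange embedding `v ↦ Σᵢ (ιv)ᵢ • rᵢ` (the three unit vectors at angles `0, ±2π/3`)
and multilinearity (★ `MultilinearWordExpansion`) they become word sums with letter-invariant
coefficients, to which Chevalley for symmetric word forms (★ `SymmetricVectorFormEsymm`, graded)
applies; the elementary symmetric polynomials of the embedded point are `(0, −u/3, 2v/27)`, so by
weighted homogeneity (★ `WeightedHomogeneousEvalFinThree`) each `(j!)⁻¹ T_j` is a polynomial in
`(−u/3, 2v/27)` with coefficients smooth in `z`; the Banach-valued Borel lemma in two variables with
parameters (★ `BorelCutoffSeriesBanach`, ★ `BorelCutoffSeriesSeveral`) realises the resulting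
formal series, and the weighted truncation `{2i + 3k ≤ N}` gives the estimate.

## References
* G. Glaeser, Fonctions composées différentiables, Ann. of Math. 77 (1963) 193–209, Thm. II;
  Sém. Lelong 5 (1962∕63) exp. 2, p. 4 («théorème de Newton différentiable»).
* L. Hörmander, The Analysis of Linear Partial Differential Operators I, Thm. 1.2.6 (Borel).
-/

noncomputable section

open Set Function Filter Metric Topology Finset Asymptotics
open scoped ContDiff Nat


namespace Literature.Analysis.Calculus

universe u

variable {P : Type u} [NormedAddCommGroup P] [NormedSpace ℝ P] [FiniteDimensional ℝ P]
  {E : Type u} [NormedAddCommGroup E] [NormedSpace ℝ E] [CompleteSpace E]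

/-! ## Elementary symmetric polynomials in three letters -/

/-- `e₁` in three letters. [cite: Macdonald1995, Ch. I §2 (2.1)–(2.2) (elementary symmetric functions eᵣ)] -/
theorem eval_esymm_fin_three_one (x : Fin 3 → ℝ) :
    MvPolynomial.eval x (MvPolynomial.esymm (Fin 3) ℝ 1) = x 0 + x 1 + x 2 := by
  have h : Finset.powersetCard 1 (Finset.univ : Finset (Fin 3)) = {{0}, {1}, {2}} := by decide
  simp [MvPolynomial.esymm, h, Finset.sum_insert, add_assoc]

/-- `e₂` in three letters. [cite: Macdonald1995, Ch. I §2 (2.1)–(2.2) (elementary symmetric functions eᵣ)] -/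
theorem eval_esymm_fin_three_two (x : Fin 3 → ℝ) :
    MvPolynomial.eval x (MvPolynomial.esymm (Fin 3) ℝ 2) = x 0 * x 1 + x 0 * x 2 + x 1 * x 2 := by
  have h : Finset.powersetCard 2 (Finset.univ : Finset (Fin 3)) = {{0, 1}, {0, 2}, {1, 2}} := by
    decide
  rw [MvPolynomial.esymm, map_sum, h, Finset.sum_insert (by decide), Finset.sum_insert (by decide),
    Finset.sum_singleton]
  simp [Finset.prod_insert, add_assoc]

/-- `e₃` in three letters. [cite: Macdonald1995, Ch. I §2 (2.1)–(2.2) (elementary symmetric functions eᵣ)] -/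
theorem eval_esymm_fin_three_three (x : Fin 3 → ℝ) :
    MvPolynomial.eval x (MvPolynomial.esymm (Fin 3) ℝ 3) = x 0 * x 1 * x 2 := by
  have h : Finset.powersetCard 3 (Finset.univ : Finset (Fin 3)) = {{0, 1, 2}} := by decide
  simp [MvPolynomial.esymm, h, Finset.prod_insert, mul_assoc]

/-- **Elementary symmetric polynomials of the Lagrange embedding** `(a,b) ↦ a • c₁ + b • c₂`
(`c₁ = (2/3, −1/3, −1/3)`, `c₂ = (0, √3/3, −√3/3)`, the mean-zero lift of the resolvent plane):
`(e₁, e₂, e₃) = (0, −(a² + b²)/3, 2(a³ − 3ab²)/27)`. [cite: Macdonald1995, Ch. I §2 (2.1)–(2.2) (elementary symmetric functions eᵣ)] [cite: Glaeser1963Newton, Thm. II (n = 3; Lagrange resolvent: S₃ acts on the plane as D₃)] -/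
theorem eval_esymm_lagrangeEmbedding (a b : ℝ) :
    (fun i : Fin 3 => MvPolynomial.eval
        (fun j : Fin 3 => (![2 / 3, -(1 / 3), -(1 / 3)] : Fin 3 → ℝ) j * a +
          (![0, Real.sqrt 3 / 3, -(Real.sqrt 3 / 3)] : Fin 3 → ℝ) j * b)
        (MvPolynomial.esymm (Fin 3) ℝ ((i : ℕ) + 1))) =
      ![0, -(a ^ 2 + b ^ 2) / 3, 2 * (a ^ 3 - 3 * a * b ^ 2) / 27] := by
  have h3 : Real.sqrt 3 * Real.sqrt 3 = 3 := Real.mul_self_sqrt (by norm_num)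
  funext i
  fin_cases i
  · show MvPolynomial.eval _ (MvPolynomial.esymm (Fin 3) ℝ 1) = _
    rw [eval_esymm_fin_three_one]
    simp
    ring
  · show MvPolynomial.eval _ (MvPolynomial.esymm (Fin 3) ℝ 2) = _
    rw [eval_esymm_fin_three_two]
    simp
    linear_combination (-(b ^ 2) / 9) * h3
  · show MvPolynomial.eval _ (MvPolynomial.esymm (Fin 3) ℝ 3) = _
    rw [eval_esymm_fin_three_three]
    simp
    linear_combination (-(2 * a * b ^ 2) / 27) * h3

/-! ## Slices and Taylor forms in the two variables -/

omit [FiniteDimensional ℝ P] [NormedAddCommGroup E] [NormedSpace ℝ E] [CompleteSpace E] in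
/-- The slice `w ↦ Φ (w.1, w.2, z)` is the composition of a translate of `Φ` with the linear
embedding `w ↦ (w.1, w.2, 0)`. [cite: Dieudonne1960, VIII §12 (higher derivatives; (8.12.10) chain rule with a linear map)] -/
theorem slice_eq_comp (Φ : ℝ × ℝ × P → E) (z : P) :
    (fun w : ℝ × ℝ => Φ (w.1, w.2, z)) =
      (fun q : ℝ × ℝ × P => Φ (q + ((0 : ℝ), (0 : ℝ), z))) ∘
        ((ContinuousLinearMap.fst ℝ ℝ ℝ).prod
          ((ContinuousLinearMap.snd ℝ ℝ ℝ).prod (0 : ℝ × ℝ →L[ℝ] P))) := by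
  funext w
  simp

omit [FiniteDimensional ℝ P] [CompleteSpace E] in
/-- The slices are smooth. [cite: Dieudonne1960, VIII §12 (higher derivatives; (8.12.10) chain rule with a linear map)] -/
theorem contDiff_slice {Φ : ℝ × ℝ × P → E} (hΦ : ContDiff ℝ ∞ Φ) (z : P) :
    ContDiff ℝ ∞ (fun w : ℝ × ℝ => Φ (w.1, w.2, z)) := by
  rw [slice_eq_comp]
  exact (hΦ.comp (contDiff_id.add contDiff_const)).comp (ContinuousLinearMap.contDiff _)

omit [FiniteDimensional ℝ P] [CompleteSpace E] in
/-- **Iterated derivatives of the slice** are those of `Φ` on the embedded vectors. [cite: Dieudonne1960, VIII §12 (higher derivatives; (8.12.10) chain rule with a linear map)] -/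
theorem iteratedFDeriv_slice {Φ : ℝ × ℝ × P → E} (hΦ : ContDiff ℝ ∞ Φ) (z : P) (j : ℕ)
    (w : ℝ × ℝ) (m : Fin j → ℝ × ℝ) :
    iteratedFDeriv ℝ j (fun w : ℝ × ℝ => Φ (w.1, w.2, z)) w m =
      iteratedFDeriv ℝ j Φ (w.1, w.2, z) (fun k => ((m k).1, (m k).2, (0 : P))) := by
  have hf : ContDiff ℝ ∞ (fun q : ℝ × ℝ × P => Φ (q + ((0 : ℝ), (0 : ℝ), z))) :=
    hΦ.comp (contDiff_id.add contDiff_const)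
  rw [slice_eq_comp, ContinuousLinearMap.iteratedFDeriv_comp_right _ hf w (i := j)
    (by exact_mod_cast le_top)]
  rw [ContinuousMultilinearMap.compContinuousLinearMap_apply]
  have h := iteratedFDeriv_comp_add_right (𝕜 := ℝ) (f := Φ) j (((0 : ℝ), (0 : ℝ), z))
    (((ContinuousLinearMap.fst ℝ ℝ ℝ).prod
      ((ContinuousLinearMap.snd ℝ ℝ ℝ).prod (0 : ℝ × ℝ →L[ℝ] P))) w)
  rw [h]
  congr 1
  · simp

omit [FiniteDimensional ℝ P] [CompleteSpace E] in
/-- Norm bound for the iterated derivatives of the slice. [cite: Dieudonne1960, VIII §12 (higher derivatives; (8.12.10) chain rule with a linear map)] -/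
theorem norm_iteratedFDeriv_slice_le {Φ : ℝ × ℝ × P → E} (hΦ : ContDiff ℝ ∞ Φ) (z : P) (j : ℕ)
    (w : ℝ × ℝ) :
    ‖iteratedFDeriv ℝ j (fun w : ℝ × ℝ => Φ (w.1, w.2, z)) w‖ ≤
      ‖iteratedFDeriv ℝ j Φ (w.1, w.2, z)‖ := by
  apply ContinuousMultilinearMap.opNorm_le_bound (norm_nonneg _)
  intro m
  rw [iteratedFDeriv_slice hΦ z j w m]
  refine (ContinuousMultilinearMap.le_opNorm _ _).trans ?_
  gcongr with k _
  simp only [Prod.norm_def, norm_zero]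
  exact max_le (le_max_left _ _)
    (max_le (le_max_right _ _) ((norm_nonneg _).trans (le_max_left _ _)))

omit [CompleteSpace E] in
/-- **Taylor expansion of `Φ` in the two variables, value-flat form** (from ★ `RayTaylor`): with
`T_j(z; v) = Dʲ(Φ(·,·,z))(0)[v,…,v]`,
`Φ (a, b, z) − Σ_{j ≤ N} (j!)⁻¹ T_j(z; (a,b)) = O(‖(a,b)‖^{N+1})` near `(0, 0, z₀)`. [cite: HormanderALPDO1, §1.1 (1.1.7)′–(1.1.8) (Taylor's formula with remainder)] -/
theorem isBigO_sub_taylorSum_slice {Φ : ℝ × ℝ × P → E} (hΦ : ContDiff ℝ ∞ Φ) (z₀ : P) (N : ℕ) :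
    (fun q : ℝ × ℝ × P => Φ q - ∑ j ∈ Finset.range (N + 1), ((j ! : ℝ)⁻¹) •
        iteratedFDeriv ℝ j (fun w : ℝ × ℝ => Φ (w.1, w.2, q.2.2)) 0 (fun _ => (q.1, q.2.1)))
      =O[𝓝 ((0, 0, z₀) : ℝ × ℝ × P)] fun q => ‖(q.1, q.2.1)‖ ^ (N + 1) := by
  -- a uniform bound for `D^{N+1} Φ` near `(0, 0, z₀)`
  obtain ⟨K, hK⟩ : ∃ K, ∀ q ∈ closedBall ((0, 0, z₀) : ℝ × ℝ × P) 1,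
      ‖iteratedFDeriv ℝ (N + 1) Φ q‖ ≤ K := by
    have hc : Continuous fun q => iteratedFDeriv ℝ (N + 1) Φ q :=
      hΦ.continuous_iteratedFDeriv (by exact_mod_cast le_top)
    obtain ⟨K, hK⟩ := (isCompact_closedBall ((0, 0, z₀) : ℝ × ℝ × P) 1).exists_bound_of_continuousOn
      hc.norm.continuousOn
    exact ⟨K, fun q hq => (le_abs_self _).trans ((Real.norm_eq_abs _).symm.le.trans (hK q hq))⟩
  refine IsBigO.of_bound (K / N !) ?_
  have hball : closedBall ((0, 0, z₀) : ℝ × ℝ × P) 1 ∈ 𝓝 ((0, 0, z₀) : ℝ × ℝ × P) :=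
    closedBall_mem_nhds _ one_pos
  filter_upwards [hball] with q hq
  rw [mem_closedBall, dist_eq_norm] at hq
  have hz : ‖q.2.2 - z₀‖ ≤ 1 := by
    have : ‖(q - (0, 0, z₀)).2.2‖ ≤ ‖q - (0, 0, z₀)‖ := (norm_snd_le _).trans (norm_snd_le _)
    simpa using this.trans hq
  -- Taylor along the ray for the slice at height `q.2.2`
  set g : ℝ × ℝ → E := fun w => Φ (w.1, w.2, q.2.2) with hg
  have hgc : ContDiff ℝ ((N + 1 : ℕ) : WithTop ℕ∞) g :=
    (contDiff_slice hΦ q.2.2).of_le (by exact_mod_cast le_top)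
  have hKg : ∀ w ∈ closedBall (0 : ℝ × ℝ) 1, ‖iteratedFDeriv ℝ (N + 1) g w‖ ≤ K := by
    intro w hw
    refine (norm_iteratedFDeriv_slice_le hΦ q.2.2 (N + 1) w).trans (hK _ ?_)
    rw [mem_closedBall, dist_zero_right] at hw
    rw [mem_closedBall, dist_eq_norm]
    have : ((w.1, w.2, q.2.2) : ℝ × ℝ × P) - (0, 0, z₀) = (w.1, w.2, q.2.2 - z₀) := by simp
    rw [this, Prod.norm_def, Prod.norm_def]
    refine max_le ?_ (max_le ?_ hz)
    · exact (norm_fst_le w).trans hw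
    · exact (norm_snd_le w).trans hw
  have hv : ‖((q.1, q.2.1) : ℝ × ℝ)‖ ≤ 1 := by
    have h1 : ‖(q - (0, 0, z₀)).1‖ ≤ ‖q - (0, 0, z₀)‖ := norm_fst_le _
    have h2 : ‖(q - (0, 0, z₀)).2.1‖ ≤ ‖q - (0, 0, z₀)‖ := (norm_fst_le _).trans (norm_snd_le _)
    simp only [Prod.fst_sub, Prod.snd_sub, sub_zero] at h1 h2
    rw [Prod.norm_def]
    exact max_le (h1.trans hq) (h2.trans hq)
  have h := norm_sub_raySum_le hgc hKg hv
  have hsum : ∑ j ∈ Finset.range (N + 1), ((j ! : ℝ)⁻¹) • iteratedDeriv j (rayFun g (q.1, q.2.1)) 0 =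
      ∑ j ∈ Finset.range (N + 1), ((j ! : ℝ)⁻¹) •
        iteratedFDeriv ℝ j (fun w : ℝ × ℝ => Φ (w.1, w.2, q.2.2)) 0 (fun _ => (q.1, q.2.1)) := by
    refine Finset.sum_congr rfl fun j hj => ?_
    rw [iteratedDeriv_rayFun hgc (q.1, q.2.1) (j := j) ?_ 0, zero_smul]
    have : j ≤ N + 1 := (Finset.mem_range.1 hj).le
    exact_mod_cast this
  have hgq : g (q.1, q.2.1) = Φ q := by simp [hg]
  rw [hsum, hgq] at h
  rw [Real.norm_of_nonneg (pow_nonneg (norm_nonneg _) _)]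
  calc ‖Φ q - ∑ j ∈ Finset.range (N + 1), ((j ! : ℝ)⁻¹) •
          iteratedFDeriv ℝ j (fun w : ℝ × ℝ => Φ (w.1, w.2, q.2.2)) 0 (fun _ => (q.1, q.2.1))‖
      ≤ K * ‖((q.1, q.2.1) : ℝ × ℝ)‖ ^ (N + 1) / N ! := h
    _ = K / N ! * ‖((q.1, q.2.1) : ℝ × ℝ)‖ ^ (N + 1) := by ring

/-! ## Invariance of the Taylor forms -/

omit [FiniteDimensional ℝ P] [CompleteSpace E] in
/-- **Taylor forms inherit linear symmetries**: if `Φ (S w, z) = Φ (w, z)` for a continuous linear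
`S`, then `Dʲ(Φ(·, z))(0)[Sv, …, Sv] = Dʲ(Φ(·, z))(0)[v, …, v]`. [cite: Dieudonne1960, VIII §12 (higher derivatives; (8.12.10) chain rule with a linear map)] -/
theorem iteratedFDeriv_slice_comp_linear {Φ : ℝ × ℝ × P → E} (hΦ : ContDiff ℝ ∞ Φ)
    (S : ℝ × ℝ →L[ℝ] ℝ × ℝ) (hS : ∀ (w : ℝ × ℝ) (z : P), Φ ((S w).1, (S w).2, z) = Φ (w.1, w.2, z))
    (j : ℕ) (z : P) (m : Fin j → ℝ × ℝ) :
    iteratedFDeriv ℝ j (fun w : ℝ × ℝ => Φ (w.1, w.2, z)) 0 (fun k => S (m k)) =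
      iteratedFDeriv ℝ j (fun w : ℝ × ℝ => Φ (w.1, w.2, z)) 0 m := by
  have hg := contDiff_slice hΦ z
  have hcomp : (fun w : ℝ × ℝ => Φ (w.1, w.2, z)) ∘ (S : ℝ × ℝ → ℝ × ℝ) =
      fun w : ℝ × ℝ => Φ (w.1, w.2, z) := by
    funext w
    exact hS w z
  have h := ContinuousLinearMap.iteratedFDeriv_comp_right S hg 0 (i := j) (by exact_mod_cast le_top)
  rw [hcomp, map_zero] at h
  have h' := congrArg (fun M : ContinuousMultilinearMap ℝ (fun _ : Fin j => ℝ × ℝ) E => M m) h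
  simp only [ContinuousMultilinearMap.compContinuousLinearMap_apply] at h'
  exact h'.symm

/-! ## Transport to the three letters -/

/-- The Lagrange projection `x ↦ (x₀ − (x₁+x₂)/2, (√3/2)(x₁ − x₂))` as a continuous linear map. [cite: Glaeser1963Newton, Thm. II (n = 3; Lagrange resolvent: S₃ acts on the plane as D₃)] -/
theorem lagrangeProj_def :
    ∃ p : (Fin 3 → ℝ) →L[ℝ] ℝ × ℝ, ∀ x : Fin 3 → ℝ,
      p x = (x 0 - (x 1 + x 2) / 2, Real.sqrt 3 / 2 * (x 1 - x 2)) := by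
  let e : Fin 3 → ((Fin 3 → ℝ) →L[ℝ] ℝ) := fun i => ContinuousLinearMap.proj i
  refine ⟨(e 0 - (1 / 2 : ℝ) • (e 1 + e 2)).prod ((Real.sqrt 3 / 2) • (e 1 - e 2)), fun x => ?_⟩
  refine Prod.ext ?_ ?_
  · simp [e]
    ring
  · simp [e]

/-! ## The letter symmetries act through `D₃` -/

/-- The three unit vectors at angles `0, 2π/3, 4π/3` (images of the letters under the Lagrange
projection). [cite: Glaeser1963Newton, Thm. II (n = 3; Lagrange resolvent: S₃ acts on the plane as D₃)] -/
theorem roots_def : ∃ r : Fin 3 → ℝ × ℝ,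
    r 0 = (1, 0) ∧ r 1 = (-(1 / 2), Real.sqrt 3 / 2) ∧ r 2 = (-(1 / 2), -(Real.sqrt 3 / 2)) :=
  ⟨![(1, 0), (-(1 / 2), Real.sqrt 3 / 2), (-(1 / 2), -(Real.sqrt 3 / 2))], rfl, rfl, rfl⟩

omit [NormedAddCommGroup P] [NormedSpace ℝ P] [FiniteDimensional ℝ P] [NormedAddCommGroup E]
  [NormedSpace ℝ E] [CompleteSpace E] in
/-- **Every letter permutation acts on the three root vectors through a linear symmetry of `Φ`**
(the reflection `(a,b) ↦ (a,−b)`, the rotation by `2π/3`, and their products). [cite: Glaeser1963Newton, Thm. II (n = 3; Lagrange resolvent: S₃ acts on the plane as D₃)] -/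
theorem exists_clm_of_perm (Φ : ℝ × ℝ × P → E)
    (heven : ∀ (a b : ℝ) (z : P), Φ (a, -b, z) = Φ (a, b, z))
    (hrot : ∀ (a b : ℝ) (z : P),
      Φ (-(1 / 2) * a - Real.sqrt 3 / 2 * b, Real.sqrt 3 / 2 * a - (1 / 2) * b, z) = Φ (a, b, z))
    (r : Fin 3 → ℝ × ℝ) (hr0 : r 0 = (1, 0)) (hr1 : r 1 = (-(1 / 2), Real.sqrt 3 / 2))
    (hr2 : r 2 = (-(1 / 2), -(Real.sqrt 3 / 2))) (σ : Equiv.Perm (Fin 3)) :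
    ∃ M : ℝ × ℝ →L[ℝ] ℝ × ℝ, (∀ (w : ℝ × ℝ) (z : P), Φ ((M w).1, (M w).2, z) = Φ (w.1, w.2, z)) ∧
      ∀ i : Fin 3, r (σ i) = M (r i) := by
  have h3 : Real.sqrt 3 * Real.sqrt 3 = 3 := Real.mul_self_sqrt (by norm_num)
  -- the reflection and the rotation
  set S₀ : ℝ × ℝ →L[ℝ] ℝ × ℝ :=
    (ContinuousLinearMap.fst ℝ ℝ ℝ).prod (-ContinuousLinearMap.snd ℝ ℝ ℝ) with hS₀
  set R : ℝ × ℝ →L[ℝ] ℝ × ℝ :=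
    ((-(1 / 2 : ℝ)) • ContinuousLinearMap.fst ℝ ℝ ℝ - (Real.sqrt 3 / 2) • ContinuousLinearMap.snd ℝ ℝ ℝ).prod
      ((Real.sqrt 3 / 2) • ContinuousLinearMap.fst ℝ ℝ ℝ - (1 / 2 : ℝ) • ContinuousLinearMap.snd ℝ ℝ ℝ)
    with hR
  have hS₀a : ∀ w : ℝ × ℝ, S₀ w = (w.1, -w.2) := fun w => by simp [hS₀]
  have hRa : ∀ w : ℝ × ℝ,
      R w = (-(1 / 2) * w.1 - Real.sqrt 3 / 2 * w.2, Real.sqrt 3 / 2 * w.1 - (1 / 2) * w.2) := by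
    intro w
    simp only [hR, ContinuousLinearMap.prod_apply, FunLike.coe_sub, Pi.sub_apply,
      FunLike.coe_smul, Pi.smul_apply, ContinuousLinearMap.coe_fst',
      ContinuousLinearMap.coe_snd', smul_eq_mul]
  have hS₀inv : ∀ (w : ℝ × ℝ) (z : P), Φ ((S₀ w).1, (S₀ w).2, z) = Φ (w.1, w.2, z) := by
    intro w z; rw [hS₀a]; exact heven w.1 w.2 z
  have hRinv : ∀ (w : ℝ × ℝ) (z : P), Φ ((R w).1, (R w).2, z) = Φ (w.1, w.2, z) := by
    intro w z; rw [hRa]; exact hrot w.1 w.2 z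
  -- the predicate is multiplicative
  let Good : Equiv.Perm (Fin 3) → Prop := fun τ =>
    ∃ M : ℝ × ℝ →L[ℝ] ℝ × ℝ, (∀ (w : ℝ × ℝ) (z : P), Φ ((M w).1, (M w).2, z) = Φ (w.1, w.2, z)) ∧
      ∀ i : Fin 3, r (τ i) = M (r i)
  have hmul : ∀ τ₁ τ₂, Good τ₁ → Good τ₂ → Good (τ₁ * τ₂) := by
    rintro τ₁ τ₂ ⟨M₁, hM₁, hr₁⟩ ⟨M₂, hM₂, hr₂⟩
    refine ⟨M₁.comp M₂, fun w z => ?_, fun i => ?_⟩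
    · rw [ContinuousLinearMap.comp_apply, hM₁, hM₂]
    · rw [Equiv.Perm.mul_apply, hr₁, hr₂, ContinuousLinearMap.comp_apply]
  have hone : Good 1 := ⟨ContinuousLinearMap.id ℝ _, fun w z => rfl, fun i => by simp⟩
  -- the three transpositions
  have h12 : Good (Equiv.swap 1 2) := by
    refine ⟨S₀, hS₀inv, fun i => ?_⟩
    fin_cases i
    · show r (Equiv.swap (1 : Fin 3) 2 0) = S₀ (r 0)
      rw [show Equiv.swap (1 : Fin 3) 2 0 = 0 from by decide, hS₀a, hr0]; simp
    · show r (Equiv.swap (1 : Fin 3) 2 1) = S₀ (r 1)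
      rw [Equiv.swap_apply_left, hS₀a, hr1, hr2]
    · show r (Equiv.swap (1 : Fin 3) 2 2) = S₀ (r 2)
      rw [Equiv.swap_apply_right, hS₀a, hr1, hr2]; simp
  have h01 : Good (Equiv.swap 0 1) := by
    refine ⟨R.comp S₀, fun w z => by rw [ContinuousLinearMap.comp_apply, hRinv, hS₀inv], fun i => ?_⟩
    fin_cases i
    · show r (Equiv.swap (0 : Fin 3) 1 0) = R (S₀ (r 0))
      rw [Equiv.swap_apply_left, hS₀a, hRa, hr0, hr1]
      simp
    · show r (Equiv.swap (0 : Fin 3) 1 1) = R (S₀ (r 1))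
      rw [Equiv.swap_apply_right, hS₀a, hRa, hr0, hr1]
      refine Prod.ext ?_ ?_
      · show _ = _; linear_combination (-(1 / 4)) * h3
      · show _ = _; ring
    · show r (Equiv.swap (0 : Fin 3) 1 2) = R (S₀ (r 2))
      rw [show Equiv.swap (0 : Fin 3) 1 2 = 2 from by decide, hS₀a, hRa, hr2]
      refine Prod.ext ?_ ?_
      · show _ = _; linear_combination (1 / 4) * h3
      · show _ = _; ring
  have h02 : Good (Equiv.swap 0 2) := by
    refine ⟨R.comp (R.comp S₀), fun w z => by
      rw [ContinuousLinearMap.comp_apply, ContinuousLinearMap.comp_apply, hRinv, hRinv, hS₀inv],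
      fun i => ?_⟩
    fin_cases i
    · show r (Equiv.swap (0 : Fin 3) 2 0) = R (R (S₀ (r 0)))
      rw [Equiv.swap_apply_left, hS₀a, hRa, hRa, hr0, hr2]
      refine Prod.ext ?_ ?_
      · show _ = _; linear_combination (1 / 4) * h3
      · show _ = _; ring
    · show r (Equiv.swap (0 : Fin 3) 2 1) = R (R (S₀ (r 1)))
      rw [show Equiv.swap (0 : Fin 3) 2 1 = 1 from by decide, hS₀a, hRa, hRa, hr1]
      refine Prod.ext ?_ ?_
      · show _ = _; linear_combination (1 / 8) * h3
      · show _ = _; linear_combination (-(Real.sqrt 3 / 8)) * h3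
    · show r (Equiv.swap (0 : Fin 3) 2 2) = R (R (S₀ (r 2)))
      rw [Equiv.swap_apply_right, hS₀a, hRa, hRa, hr0, hr2]
      refine Prod.ext ?_ ?_
      · show _ = _; linear_combination (-(3 / 8)) * h3
      · show _ = _; linear_combination (Real.sqrt 3 / 8) * h3
  -- every transposition, then every permutation
  have hswap : ∀ x y : Fin 3, x ≠ y → Good (Equiv.swap x y) := by
    intro x y hxy
    fin_cases x <;> fin_cases y
    all_goals first
      | exact absurd rfl hxy
      | exact h01
      | exact h02
      | exact h12
      | (rw [Equiv.swap_comm]; first | exact h01 | exact h02 | exact h12)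
  exact Equiv.Perm.swap_induction_on σ hone fun τ x y hxy hτ => hmul _ _ (hswap x y hxy) hτ

omit [FiniteDimensional ℝ P] [CompleteSpace E] in
/-- Iterated derivatives of the slice at the origin. [cite: Dieudonne1960, VIII §12 (higher derivatives; (8.12.10) chain rule with a linear map)] -/
theorem iteratedFDeriv_slice_zero {Φ : ℝ × ℝ × P → E} (hΦ : ContDiff ℝ ∞ Φ) (z : P) (j : ℕ)
    (m : Fin j → ℝ × ℝ) :
    iteratedFDeriv ℝ j (fun w : ℝ × ℝ => Φ (w.1, w.2, z)) 0 m =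
      iteratedFDeriv ℝ j Φ ((0 : ℝ), (0 : ℝ), z) (fun k => ((m k).1, (m k).2, (0 : P))) := by
  rw [iteratedFDeriv_slice hΦ z j 0 m]
  rfl

/-! ## The formal part at the corner -/

/-- **Formal part of Glaeser–Chevalley for `D₃` at the corner** (brick B1 of the Glaeser road):
for a smooth `Φ : ℝ × ℝ × P → E` which is even in `b` and invariant under the rotation by `2π/3`
there is a smooth `G₀` of the invariants `u = a² + b²`, `v = a³ − 3ab²` such that `Φ − G₀ ∘ π`
vanishes to infinite order along the corner line `a = b = 0`, in value-flat form.
[cite: Glaeser1963Newton, Thm. II] [cite: HormanderALPDO1, Thm. 1.2.6 (Borel)] -/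
theorem exists_contDiff_sub_comp_dihedralInvariants_isBigO (Φ : ℝ × ℝ × P → E)
    (hΦ : ContDiff ℝ ∞ Φ) (heven : ∀ (a b : ℝ) (z : P), Φ (a, -b, z) = Φ (a, b, z))
    (hrot : ∀ (a b : ℝ) (z : P),
      Φ (-(1 / 2) * a - Real.sqrt 3 / 2 * b, Real.sqrt 3 / 2 * a - (1 / 2) * b, z) = Φ (a, b, z)) :
    ∃ G₀ : ℝ × ℝ × P → E, ContDiff ℝ ∞ G₀ ∧ ∀ (z₀ : P) (N : ℕ),
      (fun q : ℝ × ℝ × P =>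
          Φ q - G₀ (q.1 ^ 2 + q.2.1 ^ 2, q.1 ^ 3 - 3 * q.1 * q.2.1 ^ 2, q.2.2))
        =O[𝓝 ((0, 0, z₀) : ℝ × ℝ × P)] fun q : ℝ × ℝ × P => ‖(q.1, q.2.1)‖ ^ N := by
  classical
  have h3 : Real.sqrt 3 * Real.sqrt 3 = 3 := Real.mul_self_sqrt (by norm_num)
  obtain ⟨r, hr0, hr1, hr2⟩ := roots_def
  -- the Lagrange embedding and `v = Σ (ι v)ᵢ • rᵢ`
  set ι : ℝ × ℝ → (Fin 3 → ℝ) := fun v j =>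
    (![2 / 3, -(1 / 3), -(1 / 3)] : Fin 3 → ℝ) j * v.1 +
      (![0, Real.sqrt 3 / 3, -(Real.sqrt 3 / 3)] : Fin 3 → ℝ) j * v.2 with hι
  have hιr : ∀ v : ℝ × ℝ, v = ∑ i, ι v i • r i := by
    intro v
    rw [Fin.sum_univ_three, hr0, hr1, hr2]
    simp only [hι, Matrix.cons_val_zero, Matrix.cons_val_one, Matrix.cons_val_two,
      Matrix.head_cons, Matrix.tail_cons, Prod.smul_mk, smul_eq_mul, Prod.mk_add_mk]
    refine Prod.ext ?_ ?_
    · show _ = _; ring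
    · show _ = _; linear_combination (-(v.2 / 3)) * h3
  -- word coefficients of the Taylor forms
  set c : (j : ℕ) → (Fin j → Fin 3) → P → E := fun j w z =>
    iteratedFDeriv ℝ j Φ ((0 : ℝ), (0 : ℝ), z) (fun k => ((r (w k)).1, (r (w k)).2, (0 : P)))
    with hc
  have hc_smooth : ∀ (j : ℕ) (w : Fin j → Fin 3), ContDiff ℝ ∞ (c j w) := by
    intro j w
    have h1 : ContDiff ℝ ∞ (iteratedFDeriv ℝ j Φ) :=
      hΦ.iteratedFDeriv_right (m := ∞) (by exact_mod_cast le_top)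
    have h2 : ContDiff ℝ ∞ (fun z : P => iteratedFDeriv ℝ j Φ ((0 : ℝ), (0 : ℝ), z)) :=
      h1.comp (contDiff_const.prodMk (contDiff_const.prodMk contDiff_id))
    exact (ContinuousMultilinearMap.apply ℝ (fun _ : Fin j => ℝ × ℝ × P) E
      (fun k => ((r (w k)).1, (r (w k)).2, (0 : P)))).contDiff.comp h2
  have hc_symm : ∀ (j : ℕ) (σ : Equiv.Perm (Fin 3)) (w : Fin j → Fin 3), c j (σ ∘ w) = c j w := by
    intro j σ w
    obtain ⟨M, hM, hMr⟩ := exists_clm_of_perm Φ heven hrot r hr0 hr1 hr2 σ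
    funext z
    simp only [hc, Function.comp_apply, hMr]
    rw [← iteratedFDeriv_slice_zero hΦ z j (fun k => M (r (w k))),
      iteratedFDeriv_slice_comp_linear hΦ M hM j z, iteratedFDeriv_slice_zero hΦ z j]
  -- the Taylor forms through the words
  have hT : ∀ (j : ℕ) (z : P) (v : ℝ × ℝ),
      iteratedFDeriv ℝ j (fun w : ℝ × ℝ => Φ (w.1, w.2, z)) 0 (fun _ => v) =
        ∑ w : Fin j → Fin 3, (∏ k, ι v (w k)) • c j w z := by
    intro j z v
    conv_lhs => rw [hιr v]
    rw [iteratedFDeriv_apply_sum_smul_eq_sum_prod_smul]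
    refine Finset.sum_congr rfl fun w _ => ?_
    rw [iteratedFDeriv_slice_zero hΦ z j]
  -- Chevalley for the word forms, degree by degree (coefficients in the module `P → E`)
  have hQ : ∀ j : ℕ, ∃ Q : (Fin j → Fin 3) → MvPolynomial (Fin 3) ℝ,
      (∀ w, (Q w).IsWeightedHomogeneous (fun i : Fin 3 => (i : ℕ) + 1) j) ∧
      ∀ x : Fin 3 → ℝ, ∑ w, (∏ k, x (w k)) • c j w =
        ∑ w, MvPolynomial.eval
          (fun i : Fin 3 => MvPolynomial.eval x (MvPolynomial.esymm (Fin 3) ℝ ((i : ℕ) + 1)))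
          (Q w) • c j w :=
    fun j => Literature.RingTheory.MvPolynomial.exists_mvPolynomial_esymm_repr_of_perm_invariant_eval
      (M := P → E) (c j) (hc_symm j)
  choose Q hQwh hQev using hQ
  -- the invariant coordinates on the slice and the coefficient functions
  set y₁ : ℝ × ℝ → ℝ := fun v => -(v.1 ^ 2 + v.2 ^ 2) / 3 with hy₁
  set y₂ : ℝ × ℝ → ℝ := fun v => 2 * (v.1 ^ 3 - 3 * v.1 * v.2 ^ 2) / 27 with hy₂
  set S : ℕ → Finset (ℕ × ℕ) := fun d =>
    ((Finset.range (d + 1)) ×ˢ (Finset.range (d + 1))).filter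
      (fun ij : ℕ × ℕ => 2 * ij.1 + 3 * ij.2 = d) with hS
  set qq : (j : ℕ) → ℕ → ℕ → P → E := fun j i k z =>
    ∑ w : Fin j → Fin 3, MvPolynomial.coeff (Finsupp.single 1 i + Finsupp.single 2 k) (Q j w) •
      c j w z with hqq
  set q : ℕ → ℕ → P → E := fun i k z =>
    (((2 * i + 3 * k) ! : ℝ))⁻¹ • qq (2 * i + 3 * k) i k z with hq
  have hq_smooth : ∀ i k, ContDiff ℝ ∞ (q i k) := by
    intro i k
    simp only [hq, hqq]
    exact contDiff_const.smul (ContDiff.sum fun w _ => contDiff_const.smul (hc_smooth _ w))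
  -- expansion of the Taylor forms in the invariant coordinates
  have hTexp : ∀ (j : ℕ) (z : P) (v : ℝ × ℝ),
      ((j ! : ℝ))⁻¹ • iteratedFDeriv ℝ j (fun w : ℝ × ℝ => Φ (w.1, w.2, z)) 0 (fun _ => v) =
        ∑ ik ∈ S j, (y₁ v ^ ik.1 * y₂ v ^ ik.2) • q ik.1 ik.2 z := by
    intro j z v
    rw [hT]
    have hev := congrFun (hQev j (ι v)) z
    simp only [Finset.sum_apply, Pi.smul_apply] at hev
    rw [hev]
    have hes : (fun i : Fin 3 =>
        MvPolynomial.eval (ι v) (MvPolynomial.esymm (Fin 3) ℝ ((i : ℕ) + 1))) =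
          ![0, y₁ v, y₂ v] := by
      have := eval_esymm_lagrangeEmbedding v.1 v.2
      simpa only [hι, hy₁, hy₂] using this
    rw [hes]
    simp_rw [Literature.RingTheory.MvPolynomial.eval_eq_sum_filter_of_isWeightedHomogeneous _
      (hQwh j _) (y₁ v) (y₂ v)]
    rw [Finset.smul_sum]
    simp_rw [Finset.sum_smul, Finset.smul_sum]
    rw [Finset.sum_comm]
    refine Finset.sum_congr rfl fun ik hik => ?_
    have hjk : 2 * ik.1 + 3 * ik.2 = j := (Finset.mem_filter.1 hik).2
    subst hjk
    simp only [hq, hqq, Finset.smul_sum, smul_smul]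
    refine Finset.sum_congr rfl fun w _ => ?_
    congr 1
    ring
  -- the key identity: Taylor sums are polynomials in the invariants
  set Rset : ℕ → Finset (ℕ × ℕ) := fun N =>
    ((Finset.range (N + 1)) ×ˢ (Finset.range (N + 1))).filter
      (fun ij : ℕ × ℕ => 2 * ij.1 + 3 * ij.2 ≤ N) with hRset
  have hkey : ∀ (N : ℕ) (z : P) (v : ℝ × ℝ),
      ∑ j ∈ Finset.range (N + 1), ((j ! : ℝ))⁻¹ •
          iteratedFDeriv ℝ j (fun w : ℝ × ℝ => Φ (w.1, w.2, z)) 0 (fun _ => v) =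
        ∑ ik ∈ Rset N, (y₁ v ^ ik.1 * y₂ v ^ ik.2) • q ik.1 ik.2 z := by
    intro N z v
    simp_rw [hTexp]
    symm
    rw [← Finset.sum_fiberwise_of_maps_to (s := Rset N) (t := Finset.range (N + 1))
      (g := fun ik : ℕ × ℕ => 2 * ik.1 + 3 * ik.2) ?_]
    · refine Finset.sum_congr rfl fun j hj => ?_
      have hjN : j < N + 1 := Finset.mem_range.1 hj
      have hfib : (Rset N).filter (fun ik : ℕ × ℕ => 2 * ik.1 + 3 * ik.2 = j) = S j := by
        ext ik
        simp only [hRset, hS, Finset.mem_filter, Finset.mem_product, Finset.mem_range]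
        omega
      rw [hfib]
    · intro ik hik
      simp only [hRset, Finset.mem_filter, Finset.mem_product, Finset.mem_range] at hik
      simp only [Finset.mem_range]
      omega
  -- Borel realisation of the formal series `Σ y₁ⁱ y₂ᵏ • q i k z`
  obtain ⟨G, hG, -, hGflat⟩ := exists_contDiff_isBigO_sub_taylorSum₂
    (fun i k z => ((i ! : ℝ) * k !) • q i k z)
    (fun i k => contDiff_const.smul (hq_smooth i k))
  refine ⟨fun y => G (-(y.1) / 3, 2 * y.2.1 / 27, y.2.2), hG.comp (by fun_prop), fun z₀ N => ?_⟩
  -- notation for the final estimate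
  set Y : ℝ × ℝ × P → ℝ × ℝ × P := fun q => (y₁ (q.1, q.2.1), y₂ (q.1, q.2.1), q.2.2) with hY
  have hG₀ : ∀ q : ℝ × ℝ × P,
      G (-(q.1 ^ 2 + q.2.1 ^ 2) / 3, 2 * (q.1 ^ 3 - 3 * q.1 * q.2.1 ^ 2) / 27, q.2.2) = G (Y q) := by
    intro q; simp only [hY, hy₁, hy₂]
  simp only [hG₀]
  -- (F1) `Y` is continuous and fixes the corner line
  have hYt : Tendsto Y (𝓝 ((0, 0, z₀) : ℝ × ℝ × P)) (𝓝 ((0, 0, z₀) : ℝ × ℝ × P)) := by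
    have hYc : Continuous Y := by simp only [hY, hy₁, hy₂]; fun_prop
    have h0 : Y (0, 0, z₀) = (0, 0, z₀) := by simp [hY, hy₁, hy₂]
    simpa [h0] using hYc.tendsto ((0, 0, z₀) : ℝ × ℝ × P)
  -- (F2)/(F3) size of the invariant coordinates on the unit ball
  have hball : ∀ᶠ q : ℝ × ℝ × P in 𝓝 ((0, 0, z₀) : ℝ × ℝ × P), ‖(q.1, q.2.1)‖ ≤ 1 := by
    have : Metric.ball ((0, 0, z₀) : ℝ × ℝ × P) 1 ∈ 𝓝 ((0, 0, z₀) : ℝ × ℝ × P) :=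
      Metric.ball_mem_nhds _ one_pos
    filter_upwards [this] with q hq
    rw [Metric.mem_ball, dist_eq_norm] at hq
    have h1 : ‖(q - (0, 0, z₀)).1‖ ≤ ‖q - (0, 0, z₀)‖ := norm_fst_le _
    have h2 : ‖(q - (0, 0, z₀)).2.1‖ ≤ ‖q - (0, 0, z₀)‖ := (norm_fst_le _).trans (norm_snd_le _)
    simp only [Prod.fst_sub, Prod.snd_sub, sub_zero] at h1 h2
    rw [Prod.norm_def]
    exact max_le (h1.trans hq.le) (h2.trans hq.le)
  have hy₁le : ∀ v : ℝ × ℝ, |y₁ v| ≤ ‖v‖ ^ 2 := by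
    intro v
    have ha : |v.1| ≤ ‖v‖ := by rw [← Real.norm_eq_abs]; exact norm_fst_le v
    have hb : |v.2| ≤ ‖v‖ := by rw [← Real.norm_eq_abs]; exact norm_snd_le v
    have ha2 : v.1 ^ 2 ≤ ‖v‖ ^ 2 := by nlinarith [abs_nonneg v.1, sq_abs v.1]
    have hb2 : v.2 ^ 2 ≤ ‖v‖ ^ 2 := by nlinarith [abs_nonneg v.2, sq_abs v.2]
    simp only [hy₁]
    rw [abs_div, abs_neg, abs_of_nonneg (by positivity : (0 : ℝ) ≤ v.1 ^ 2 + v.2 ^ 2)]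
    norm_num
    nlinarith [norm_nonneg v]
  have hy₂le : ∀ v : ℝ × ℝ, |y₂ v| ≤ ‖v‖ ^ 3 := by
    intro v
    have ha : |v.1| ≤ ‖v‖ := by rw [← Real.norm_eq_abs]; exact norm_fst_le v
    have hb : |v.2| ≤ ‖v‖ := by rw [← Real.norm_eq_abs]; exact norm_snd_le v
    have hn : 0 ≤ ‖v‖ := norm_nonneg v
    have h1 : |v.1 ^ 3| ≤ ‖v‖ ^ 3 := by
      rw [abs_pow]; exact pow_le_pow_left₀ (abs_nonneg _) ha 3
    have h2 : |3 * v.1 * v.2 ^ 2| ≤ 3 * ‖v‖ ^ 3 := by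
      rw [abs_mul, abs_mul, abs_pow]
      have : |v.2| ^ 2 ≤ ‖v‖ ^ 2 := pow_le_pow_left₀ (abs_nonneg _) hb 2
      calc |3| * |v.1| * |v.2| ^ 2 ≤ 3 * ‖v‖ * ‖v‖ ^ 2 := by
            rw [abs_of_pos (by norm_num : (0:ℝ) < 3)]
            gcongr
        _ = 3 * ‖v‖ ^ 3 := by ring
    simp only [hy₂]
    rw [abs_div, abs_mul, abs_of_pos (by norm_num : (0:ℝ) < 2),
      abs_of_pos (by norm_num : (0:ℝ) < 27)]
    have h3' : |v.1 ^ 3 - 3 * v.1 * v.2 ^ 2| ≤ 4 * ‖v‖ ^ 3 :=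
      (abs_sub _ _).trans (by linarith)
    have : 0 ≤ ‖v‖ ^ 3 := by positivity
    linarith
  have hYle : ∀ q : ℝ × ℝ × P, ‖(q.1, q.2.1)‖ ≤ 1 → ‖((Y q).1, (Y q).2.1)‖ ≤ ‖(q.1, q.2.1)‖ := by
    intro q hq
    have hn : 0 ≤ ‖(q.1, q.2.1)‖ := norm_nonneg _
    simp only [hY]
    rw [Prod.norm_def, Real.norm_eq_abs, Real.norm_eq_abs]
    refine max_le ((hy₁le _).trans ?_) ((hy₂le _).trans ?_)
    · calc ‖(q.1, q.2.1)‖ ^ 2 ≤ ‖(q.1, q.2.1)‖ ^ 1 := pow_le_pow_of_le_one hn hq (by norm_num)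
        _ = _ := pow_one _
    · calc ‖(q.1, q.2.1)‖ ^ 3 ≤ ‖(q.1, q.2.1)‖ ^ 1 := pow_le_pow_of_le_one hn hq (by norm_num)
        _ = _ := pow_one _
  -- (T1) Taylor expansion of `Φ`
  have hT1 := isBigO_sub_taylorSum_slice hΦ z₀ N
  -- (T3) Taylor expansion of `G` along `Y`
  have hT3 : (fun x : ℝ × ℝ × P => G (Y x) -
      ∑ i ∈ Finset.range (N + 1), ∑ k ∈ Finset.range (N + 1),
        ((Y x).1 ^ i * (Y x).2.1 ^ k / ((i ! : ℝ) * k !)) •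
          (((i ! : ℝ) * k !) • q i k (Y x).2.2))
      =O[𝓝 ((0, 0, z₀) : ℝ × ℝ × P)] fun x : ℝ × ℝ × P => ‖(x.1, x.2.1)‖ ^ (N + 1) := by
    refine ((hGflat z₀ N).comp_tendsto hYt).trans ?_
    refine IsBigO.of_bound 1 ?_
    filter_upwards [hball] with x hx
    simp only [Function.comp_apply, one_mul, Real.norm_of_nonneg (pow_nonneg (norm_nonneg _) _)]
    exact pow_le_pow_left₀ (norm_nonneg _) (hYle x hx) _
  -- (T2) the polynomial difference: monomials of weighted degree `> N`
  set NotS : Finset (ℕ × ℕ) := ((Finset.range (N + 1)) ×ˢ (Finset.range (N + 1))).filter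
      (fun ij : ℕ × ℕ => ¬ 2 * ij.1 + 3 * ij.2 ≤ N) with hNotS
  have hT2 : ∀ ik ∈ NotS, (fun x : ℝ × ℝ × P =>
      (y₁ (x.1, x.2.1) ^ ik.1 * y₂ (x.1, x.2.1) ^ ik.2) • q ik.1 ik.2 x.2.2)
        =O[𝓝 ((0, 0, z₀) : ℝ × ℝ × P)] fun x : ℝ × ℝ × P => ‖(x.1, x.2.1)‖ ^ (N + 1) := by
    intro ik hik
    have hdeg : N + 1 ≤ 2 * ik.1 + 3 * ik.2 := by
      simp only [hNotS, Finset.mem_filter] at hik; omega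
    -- local bound for the coefficient
    have hqb : ∀ᶠ x : ℝ × ℝ × P in 𝓝 ((0, 0, z₀) : ℝ × ℝ × P),
        ‖q ik.1 ik.2 x.2.2‖ ≤ ‖q ik.1 ik.2 z₀‖ + 1 := by
      have hc' : Continuous fun z : P => ‖q ik.1 ik.2 z‖ := (hq_smooth ik.1 ik.2).continuous.norm
      have hev : ∀ᶠ z in 𝓝 z₀, ‖q ik.1 ik.2 z‖ < ‖q ik.1 ik.2 z₀‖ + 1 :=
        (hc'.tendsto z₀).eventually (gt_mem_nhds (lt_add_one _))
      have ht : Tendsto (fun x : ℝ × ℝ × P => x.2.2) (𝓝 ((0, 0, z₀) : ℝ × ℝ × P)) (𝓝 z₀) :=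
        (continuous_snd.comp continuous_snd).tendsto ((0, 0, z₀) : ℝ × ℝ × P)
      filter_upwards [ht.eventually hev] with x hx using hx.le
    refine IsBigO.of_bound (‖q ik.1 ik.2 z₀‖ + 1) ?_
    filter_upwards [hball, hqb] with x hx hx'
    rw [norm_smul, Real.norm_of_nonneg (pow_nonneg (norm_nonneg _) _), mul_comm]
    have hn : 0 ≤ ‖(x.1, x.2.1)‖ := norm_nonneg _
    have hmono : ‖y₁ (x.1, x.2.1) ^ ik.1 * y₂ (x.1, x.2.1) ^ ik.2‖ ≤ ‖(x.1, x.2.1)‖ ^ (N + 1) := by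
      rw [norm_mul, norm_pow, norm_pow, Real.norm_eq_abs, Real.norm_eq_abs]
      calc |y₁ (x.1, x.2.1)| ^ ik.1 * |y₂ (x.1, x.2.1)| ^ ik.2
          ≤ (‖(x.1, x.2.1)‖ ^ 2) ^ ik.1 * (‖(x.1, x.2.1)‖ ^ 3) ^ ik.2 := by
            gcongr
            · exact hy₁le _
            · exact hy₂le _
        _ = ‖(x.1, x.2.1)‖ ^ (2 * ik.1 + 3 * ik.2) := by
            rw [← pow_mul, ← pow_mul, ← pow_add]
        _ ≤ ‖(x.1, x.2.1)‖ ^ (N + 1) := pow_le_pow_of_le_one hn hx hdeg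
    have hpos : 0 ≤ ‖q ik.1 ik.2 z₀‖ + 1 := by positivity
    exact mul_le_mul hx' hmono (norm_nonneg _) hpos
  -- the Borel polynomial along `Y`, monomial by monomial
  have hPN : ∀ x : ℝ × ℝ × P,
      ∑ i ∈ Finset.range (N + 1), ∑ k ∈ Finset.range (N + 1),
        ((Y x).1 ^ i * (Y x).2.1 ^ k / ((i ! : ℝ) * k !)) •
          (((i ! : ℝ) * k !) • q i k (Y x).2.2) =
      ∑ ik ∈ (Finset.range (N + 1)) ×ˢ (Finset.range (N + 1)),
        (y₁ (x.1, x.2.1) ^ ik.1 * y₂ (x.1, x.2.1) ^ ik.2) • q ik.1 ik.2 x.2.2 := by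
    intro x
    rw [Finset.sum_product]
    refine Finset.sum_congr rfl fun i _ => Finset.sum_congr rfl fun k _ => ?_
    have hne : ((i ! : ℝ) * k !) ≠ 0 := by positivity
    rw [smul_smul, div_mul_cancel₀ _ hne]
  -- assemble at order `N + 1`
  have hmain : (fun x : ℝ × ℝ × P => Φ x - G (Y x))
      =O[𝓝 ((0, 0, z₀) : ℝ × ℝ × P)] fun x : ℝ × ℝ × P => ‖(x.1, x.2.1)‖ ^ (N + 1) := by
    have hT2s := IsBigO.sum hT2
    have h := (hT1.add hT2s.neg_left).sub hT3
    refine h.congr' (Eventually.of_forall fun x => ?_) EventuallyEq.rfl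
    dsimp only
    rw [hkey N x.2.2 (x.1, x.2.1), hPN x,
      ← Finset.sum_filter_add_sum_filter_not ((Finset.range (N + 1)) ×ˢ (Finset.range (N + 1)))
        (fun ij : ℕ × ℕ => 2 * ij.1 + 3 * ij.2 ≤ N)]
    abel
  -- weaken `N + 1` to `N`
  refine hmain.trans (IsBigO.of_bound 1 ?_)
  filter_upwards [hball] with x hx
  rw [one_mul, Real.norm_of_nonneg (pow_nonneg (norm_nonneg _) _),
    Real.norm_of_nonneg (pow_nonneg (norm_nonneg _) _), pow_succ]
  exact mul_le_of_le_one_right (pow_nonneg (norm_nonneg _) _) hx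

end Literature.Analysis.Calculus
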